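import Summits.ValiantsHypothesis.ValiantsHypothesis.Theorems.MonotoneRestorationOrbitRestorationQPTermBlocks
import Summits.ValiantsHypothesis.ValiantsHypothesis.Theorems.MonotoneRestorationOrbitRestorationQPAffineFactors
import HarnessLib

/-!
# The term-block criterion in STABILISER form: projectively permuted blocks with untwisted stabilisers can be
# rescaled into an honest equivariant system (transport along orbits; ORBIT currency)

Route MonotoneRestoration, crux `OrbitRestorationQP` (stmt-ValiantsHypothesis-18293), line `depth-three-rung`, rung
`A_∞ = stub_sigmaPiSigmaValue`; namespace `Summit.ValiantsHypothesis.ValiantsHypothesis.Theorems.TermBlocks`.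

`TermBlocks.qpOrbitRestorable_of_termBlocks` (`…TermBlocks.lean`) asks for block products that are permuted EXACTLY,
`σ · Π M_b = Π M_{σ • b}` — a property of a well-chosen normalisation of the factors, not of the representation one is
given: unique factorisation only ever yields `σ · Π M_b = c · Π M_{σ • b}` with a unit `c` (sign characters, roots of
unity).  This file removes the normalisation from the hypotheses.  It suffices that

* (iii-a) the block products are permuted PROJECTIVELY: `σ · Π M_b = c(σ,b) · Π M_{σ • b}`, `c(σ,b) ≠ 0`;
* (iii-b) the blocks are UNTWISTED: the stabiliser of the block index fixes the block product, `ρ • b = b ⇒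
  ρ · Π M_b = Π M_b` (this is where the characters must die — cf. the support theorem for values,
  `ValueSymSupport.exists_symSupport`: a twisted value is never an intermediate value);
* (v) the TERMS are permuted as values: `σ · (a_t Π_{key b = t} Π M_b) = a_{σ•t} Π_{key b = σ•t} Π M_b`.

Then (`qpOrbitRestorable_of_termBlocks_stab`) the sum is `QPOrbitRestorable (k + 5)`: choosing one representative
`b₀` per orbit of blocks and transports `tr b • b₀ = b`, the rescaled blocks `M'_b := tr b · M_{b₀}` have honestly
permuted products (two transports differ by an element of the stabiliser of `b₀`, which fixes `Π M_{b₀}` by (iii-b)),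
are unit multiples of the old ones by (iii-a), keep supports and exact permutation by small pointwise stabilisers,
and the corrected coefficients `a'_t = a_t / Π_{key b = t} c_b` are invariant because both the old terms (v) and the
new block systems are permuted as values and the products are nonzero.  This is the transport step of
`SupportBlocks.qpOrbitRestorable_of_untwisted_supportBlocks` (one invariant product, blocks = supports, representatives
per cardinality), now for arbitrary finite `Sym(Fin n)`-sets of blocks and terms.

* `some_eq_of_eq` — bookkeeping for orbit representatives;
* `qpOrbitRestorable_of_termBlocks_stab` — the criterion in stabiliser form.

Honest label: positive-lane tool (makes kind (P) of the residue intrinsic: projective equivariance + untwisted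
stabilisers); the stub, the crux and VP ≠ VNP are not moved.  Everything is proved. [folklore]

## References
* A. Dawar, G. Wilsenach, *Symmetric arithmetic circuits*, ToC 21 (2025), §3.3, Def. 6.1. [DawarWilsenach2025]
-/

noncomputable section

open scoped Classical Pointwise

-- `Summit.ValiantsHypothesis.ValiantsHypothesis.…` is the tree's single-conjunct layout (Sub = Summit).
set_option linter.dupNamespace false

namespace Summit.ValiantsHypothesis.ValiantsHypothesis.Theorems

namespace TermBlocks

open Equiv Finset Literature.Computability.AlgebraicComplexity OrbitRestorationQPDepthThreeRung

variable {n : ℕ}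

/-- Chosen elements of equal nonempty sets agree. [folklore] -/
theorem some_eq_of_eq {α : Type*} {s t : Set α} (hs : s.Nonempty) (ht : t.Nonempty) (h : s = t) :
    hs.some = ht.some := by
  subst h; rfl

/-- **THE TERM-BLOCK CRITERION IN STABILISER FORM.**  Let `B` (blocks) and `T` (terms) be finite `Sym(Fin n)`-sets
with an equivariant key, `M_b` multisets of polynomials of total degree `1`, `a : T → ℂ`.  Suppose (i) every form
is fixed by the pointwise stabiliser of `≤ k` indices, (ii) every `M_b` is mapped to itself by the pointwise
stabiliser of `≤ k` indices and blocks along an orbit have the same size, (iii-a) block products are permuted up to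
nonzero scalars, (iii-b) the stabiliser of `b` fixes `Π M_b`, (iv) terms carrying a non-empty block are fixed by the
pointwise stabiliser of `≤ k` indices, (v) the terms `a_t · Π_{key b = t} Π M_b` are permuted as values.  Then
`Σ_t C(a t) · Π_{key b = t} Π M_b` is `QPOrbitRestorable (k + 5)` at level `n`.
[folklore; cite: DawarWilsenach2025, §3.3 and Def. 6.1] -/
theorem qpOrbitRestorable_of_termBlocks_stab {k : ℕ} {B T : Type} [Fintype B] [Fintype T]
    [MulAction (Perm (Fin n)) B] [MulAction (Perm (Fin n)) T]
    (key : B → T) (hkey : ∀ (σ : Perm (Fin n)) (b : B), key (σ • b) = σ • key b)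
    (M : B → Multiset (MvPolynomial (Fin n × Fin n) ℂ)) (a : T → ℂ)
    (hAff : ∀ b, ∀ q ∈ M b, q.totalDegree = 1)
    (hSupp : ∀ b, ∀ q ∈ M b, ∃ X : Finset (Fin n), X.card ≤ k ∧
      ∀ σ : Perm (Fin n), (∀ x ∈ X, σ x = x) → ren σ q = q)
    (hPerm : ∀ b, ∃ K : Finset (Fin n), K.card ≤ k ∧
      ∀ σ : Perm (Fin n), (∀ x ∈ K, σ x = x) → (M b).map (ren σ) = M b)
    (hcard : ∀ (σ : Perm (Fin n)) (b : B), Multiset.card (M (σ • b)) = Multiset.card (M b))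
    (hProj : ∀ (σ : Perm (Fin n)) (b : B), ∃ c : ℂ, c ≠ 0 ∧ ren σ (M b).prod = MvPolynomial.C c * (M (σ • b)).prod)
    (hStab : ∀ (ρ : Perm (Fin n)) (b : B), ρ • b = b → ren ρ (M b).prod = (M b).prod)
    (hT : ∀ t : T, (∃ b, key b = t ∧ M b ≠ 0) → ∃ K : Finset (Fin n), K.card ≤ k ∧
      ∀ σ : Perm (Fin n), (∀ x ∈ K, σ x = x) → σ • t = t)
    (hF : ∀ (σ : Perm (Fin n)) (t : T),
      ren σ (MvPolynomial.C (a t) * ∏ b ∈ univ.filter (fun b => key b = t), (M b).prod) =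
        MvPolynomial.C (a (σ • t)) * ∏ b ∈ univ.filter (fun b => key b = σ • t), (M b).prod) :
    QPOrbitRestorable (k + 5) n
      (∑ t, MvPolynomial.C (a t) * ∏ b ∈ univ.filter (fun b => key b = t), (M b).prod) := by
  -- orbit representatives and transports
  have hne : ∀ b : B, (MulAction.orbit (Perm (Fin n)) b).Nonempty := fun b => ⟨b, MulAction.mem_orbit_self b⟩
  let rep : B → B := fun b => (hne b).some
  have hrep_mem : ∀ b, rep b ∈ MulAction.orbit (Perm (Fin n)) b := fun b => (hne b).some_mem
  have hrep_smul : ∀ (σ : Perm (Fin n)) (b : B), rep (σ • b) = rep b := fun σ b => by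
    show (hne (σ • b)).some = (hne b).some
    exact some_eq_of_eq _ _ (MulAction.orbit_smul σ b)
  have hex : ∀ b : B, ∃ τ : Perm (Fin n), τ • rep b = b := fun b => by
    obtain ⟨σ, hσ⟩ := MulAction.mem_orbit_iff.1 (hrep_mem b)
    exact ⟨σ⁻¹, by rw [← hσ, inv_smul_smul]⟩
  choose tr htr using hex
  -- the rescaled blocks
  set M' : B → Multiset (MvPolynomial (Fin n × Fin n) ℂ) := fun b => (M (rep b)).map (ren (tr b)) with hM'
  have hM'prod : ∀ b, (M' b).prod = ren (tr b) (M (rep b)).prod := fun b => by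
    rw [hM', map_multiset_prod]
  -- honest equivariance of the rescaled block products
  have hEqv' : ∀ (σ : Perm (Fin n)) (b : B), ren σ (M' b).prod = (M' (σ • b)).prod := by
    intro σ b
    rw [hM'prod, hM'prod, hrep_smul, ← ren_mul]
    have hρ : ((tr (σ • b))⁻¹ * (σ * tr b)) • rep b = rep b := by
      rw [mul_smul, mul_smul, htr b, inv_smul_eq_iff, ← hrep_smul σ b, htr (σ • b)]
    calc ren (σ * tr b) (M (rep b)).prod
        = ren (tr (σ • b) * ((tr (σ • b))⁻¹ * (σ * tr b))) (M (rep b)).prod := by rw [mul_inv_cancel_left]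
      _ = ren (tr (σ • b)) (M (rep b)).prod := by rw [ren_mul, hStab _ _ hρ]
  -- the rescaled blocks are unit multiples of the old ones
  have hunit : ∀ b, ∃ c : ℂ, c ≠ 0 ∧ (M' b).prod = MvPolynomial.C c * (M b).prod := by
    intro b
    obtain ⟨c, hc0, hc⟩ := hProj (tr b) (rep b)
    refine ⟨c, hc0, ?_⟩
    rw [hM'prod, hc, htr b]
  choose c hc0 hc using hunit
  -- nonvanishing of block products
  have hne0 : ∀ b, (M b).prod ≠ 0 := by
    intro b
    refine Multiset.prod_ne_zero fun h0 => ?_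
    have := hAff b 0 h0
    rw [MvPolynomial.totalDegree_zero] at this
    exact absurd this (by norm_num)
  -- term products, old and new
  set G : T → MvPolynomial (Fin n × Fin n) ℂ := fun t => ∏ b ∈ univ.filter (fun b => key b = t), (M' b).prod
    with hG
  set cT : T → ℂ := fun t => ∏ b ∈ univ.filter (fun b => key b = t), c b with hcT
  have hcT0 : ∀ t, cT t ≠ 0 := fun t => prod_ne_zero_iff.2 fun b _ => hc0 b
  have hGeq : ∀ t, G t = MvPolynomial.C (cT t) * ∏ b ∈ univ.filter (fun b => key b = t), (M b).prod := by
    intro t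
    rw [hG, hcT]; dsimp only
    rw [map_prod, ← prod_mul_distrib]
    exact prod_congr rfl fun b _ => hc b
  have hG0 : ∀ t, G t ≠ 0 := fun t => by
    rw [hG]; dsimp only
    refine prod_ne_zero_iff.2 fun b _ => ?_
    rw [hc b]
    exact mul_ne_zero (by rw [Ne, MvPolynomial.C_eq_zero]; exact hc0 b) (hne0 b)
  -- equivariance of the new term products
  have hkey_iff : ∀ (σ : Perm (Fin n)) (b : B) (t : T), key (σ • b) = σ • t ↔ key b = t := fun σ b t => by
    rw [hkey]; exact (MulAction.injective σ).eq_iff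
  have hGren : ∀ (σ : Perm (Fin n)) (t : T), ren σ (G t) = G (σ • t) := by
    intro σ t
    rw [hG]; dsimp only
    rw [map_prod]
    refine Finset.prod_equiv (MulAction.toPerm σ) (fun b => ?_) (fun b _ => ?_)
    · simp only [mem_filter, mem_univ, true_and, MulAction.toPerm_apply, hkey_iff]
    · simp only [MulAction.toPerm_apply, hEqv']
  -- the corrected coefficients are invariant
  set a' : T → ℂ := fun t => a t * (cT t)⁻¹ with ha'
  have hFa' : ∀ t, MvPolynomial.C (a t) * ∏ b ∈ univ.filter (fun b => key b = t), (M b).prod =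
      MvPolynomial.C (a' t) * G t := by
    intro t
    rw [hGeq, ← mul_assoc, ← map_mul, ha']; dsimp only
    rw [mul_assoc, inv_mul_cancel₀ (hcT0 t), mul_one]
  have ha'inv : ∀ (σ : Perm (Fin n)) (t : T), a' (σ • t) = a' t := by
    intro σ t
    have h := hF σ t
    rw [hFa', hFa', map_mul, ren_C, hGren] at h
    have h2 : MvPolynomial.C (a' t - a' (σ • t)) * G (σ • t) = 0 := by rw [map_sub, sub_mul, h, sub_self]
    rcases mul_eq_zero.1 h2 with h3 | h3
    · rw [MvPolynomial.C_eq_zero, sub_eq_zero] at h3; exact h3.symm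
    · exact absurd h3 (hG0 _)
  -- rewrite the output and apply the criterion to the rescaled system
  have hout : (∑ t, MvPolynomial.C (a t) * ∏ b ∈ univ.filter (fun b => key b = t), (M b).prod) =
      ∑ t, MvPolynomial.C (a' t) * ∏ b ∈ univ.filter (fun b => key b = t), (M' b).prod :=
    Finset.sum_congr rfl fun t _ => hFa' t
  rw [hout]
  -- transported supports
  have hfixT : ∀ (b : B) (q : MvPolynomial (Fin n × Fin n) ℂ) (X : Finset (Fin n)),
      (∀ σ : Perm (Fin n), (∀ x ∈ X, σ x = x) → ren σ q = q) →
      ∀ τ : Perm (Fin n), (∀ x ∈ (tr b) • X, τ x = x) → ren τ (ren (tr b) q) = ren (tr b) q := by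
    intro b q X hX τ hτ
    have hfix' : ren ((tr b)⁻¹ * τ * tr b) q = q := hX _ fun x hx => by
      have h1 : τ (tr b • x) = tr b • x := hτ (tr b • x) (Finset.smul_mem_smul_finset hx)
      rw [Perm.smul_def] at h1
      rw [Perm.mul_apply, Perm.mul_apply, h1]
      exact (tr b).symm_apply_apply x
    calc ren τ (ren (tr b) q) = ren (tr b) (ren ((tr b)⁻¹ * τ * tr b) q) := by
          rw [← ren_mul, ← ren_mul, ← mul_assoc, ← mul_assoc, mul_inv_cancel, one_mul]
      _ = ren (tr b) q := by rw [hfix']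
  refine qpOrbitRestorable_of_termBlocks key hkey M' a' ha'inv (fun b q hq => ?_) (fun b q hq => ?_)
    (fun b => ?_) hEqv' (fun t ht => ?_)
  · -- affine
    rw [hM'] at hq
    obtain ⟨q₀, hq₀, rfl⟩ := Multiset.mem_map.1 hq
    rw [AffineFactors.totalDegree_ren]; exact (hAff _ q₀ hq₀).le
  · -- supported
    rw [hM'] at hq
    obtain ⟨q₀, hq₀, rfl⟩ := Multiset.mem_map.1 hq
    obtain ⟨X, hXk, hX⟩ := hSupp _ q₀ hq₀
    exact ⟨tr b • X, by rwa [Finset.card_smul_finset], hfixT b q₀ X hX⟩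
  · -- exactly permuted by a small pointwise stabiliser
    obtain ⟨K, hKk, hK⟩ := hPerm (rep b)
    refine ⟨tr b • K, by rwa [Finset.card_smul_finset], fun τ hτ => ?_⟩
    have hfix' : ∀ x ∈ K, ((tr b)⁻¹ * τ * tr b) x = x := fun x hx => by
      have h1 : τ (tr b • x) = tr b • x := hτ (tr b • x) (Finset.smul_mem_smul_finset hx)
      rw [Perm.smul_def] at h1
      rw [Perm.mul_apply, Perm.mul_apply, h1]
      exact (tr b).symm_apply_apply x
    have h := hK _ hfix'
    rw [hM']; dsimp only
    rw [Multiset.map_map]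
    conv_rhs => rw [← h, Multiset.map_map]
    refine Multiset.map_congr rfl fun q _ => ?_
    simp only [Function.comp_apply, ← ren_mul, ← mul_assoc, mul_inv_cancel, one_mul]
  · -- terms with a non-empty block
    obtain ⟨b, hb, hneb⟩ := ht
    refine hT t ⟨b, hb, fun h0 => hneb ?_⟩
    have h1 : Multiset.card (M (rep b)) = 0 := by
      have h2 := hcard (tr b) (rep b)
      rw [htr b, h0, Multiset.card_zero] at h2
      exact h2.symm
    rw [hM']; dsimp only
    rw [Multiset.card_eq_zero.1 h1, Multiset.map_zero]

end TermBlocks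

end Summit.ValiantsHypothesis.ValiantsHypothesis.Theorems

end
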